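import Summits.RiemannHypothesis.RiemannHypothesis.Theorems.JensenLogBandArcDescentR2Kernel
import HarnessLib

/-!
# The far-zone competitor bound, part 1: `ξ` on the competitor arc and the line `σ = 1 + δ`
# (BAND crux, far-zone input F7a/F7c)

RH ladder column JENSEN, rung J-P(P3) «log band», BAND crux `XiDerivBandRealAllRates`
(stmt-RiemannHypothesis-19913) of route «JensenLogBand», line «band-one-window» (u-arc reshape;
BAND lead rh-jensen-prover g8), registered stub `stub_farZone`. RH-FREE `Γ`-factor calculus and
the convexity bound. WHAT THIS IS NOT: nothing here bears on zeros of `ζ` or the truth of RH.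

In the far zone (`a > h − ½ − δ₁`) the competitor half-arc `u = c₋ + h e^{iθ}`, `c₋ = −a + iT`,
`|θ| ≤ π/2`, lies entirely in the closed strip `0 ≤ Re(½+u) ≤ 1 + δ₁`; there `ξ` is controlled by
the flat majorant (eng-2 g6 F2) with NO saddle analysis:

* `norm_xiSq_sq_competitor_le` (F7a): `‖ξ(½+u_θ)‖ ≤ 672·log(T+h)·e^{(4/5)h}·‖γ̃(1+δ+iT)‖` for a
  competitor arc of radius `0 < h ≤ 20` left of `1 + δ` (`T ≥ 1200`, `0 < δ ≤ 1`);
* `norm_xiGammaFactor_line_le_saddle` (F7c): in regime R2 at the OWN centre,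
  `‖γ̃(1+δ+iT)‖ ≤ e^{h/3}·e^{−(σ*−1−δ)(ℓ_T/2 − 1)}·‖γ̃(½+u*)‖` whenever `1 + δ ≤ σ* = Re(½+u*)`.

Part 2 (`JensenLogBandFarZoneCompetitor.lean`) adds the kernel comparison and the assembled bound
`‖arcIntegrandU n h c₋ θ‖ ≤ 672·log(T+h)·e^{4h+9}·e^{−(σ*−1−δ)(ℓ_T/2−1)}·‖I_{r*}(φ₀)‖`.
(prover-rh-jensen-eng-2-g6-0, 2026-08-27.)
-/

noncomputable section

-- single-problem summit: `Summit.RiemannHypothesis.RiemannHypothesis.…` is the tree convention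
set_option linter.dupNamespace false

open Complex Real Set

namespace Summit.RiemannHypothesis.RiemannHypothesis.Theorems.JensenPolynomials.LogBandArc

open Literature.NumberTheory.LFunctions

variable {n : ℕ} {x T : ℝ} {u : ℂ}

/-! ## F7a: `ξ` on a competitor arc inside the strip -/

/-- **`ξ` on a competitor arc left of `1 + δ`:** for `|x'| ≤ ½`, `0 < h ≤ 20`, `T ≥ 1200`,
`0 < δ ≤ 1`, `½ + x' + h ≤ 1 + δ` and `|θ| ≤ π/2`, with `u_θ = (x'+iT) + h e^{iθ}`:
`‖ξ(½ + u_θ)‖ ≤ 672·log(T + h)·e^{(4/5)h}·‖γ̃((1+δ) + iT)‖` (flat majorant F2 + vertical γ̃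
comparison from height `T + h sin θ` to `T`). RH-FREE. [folklore] -/
theorem norm_xiSq_sq_competitor_le {x' h T δ θ : ℝ} (hx' : |x'| ≤ 1 / 2) (hh0 : 0 < h)
    (hH : h ≤ 20) (hT : 1200 ≤ T) (hδ : 0 < δ) (hδ1 : δ ≤ 1) (hleft : 1 / 2 + x' + h ≤ 1 + δ)
    (hθ : |θ| ≤ Real.pi / 2) :
    ‖xiSq ((circleMap ((x' : ℂ) + (T : ℂ) * I) h θ) ^ 2)‖ ≤
      672 * Real.log (T + h) * Real.exp (4 / 5 * h) *
        ‖xiGammaFactor (((1 + δ : ℝ) : ℂ) + (T : ℂ) * I)‖ := by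
  rw [xiSq_sq]
  set s : ℂ := 1 / 2 + circleMap ((x' : ℂ) + (T : ℂ) * I) h θ with hs
  have hcoord := half_add_circleMap_eq x' T h θ
  have hsre : s.re = 1 / 2 + x' + h * Real.cos θ := by
    rw [hs, hcoord]
    simp only [Complex.add_re, Complex.ofReal_re, Complex.mul_re, Complex.I_re, Complex.I_im,
      Complex.ofReal_im]
    ring
  have hsim : s.im = T + h * Real.sin θ := by
    rw [hs, hcoord]
    simp only [Complex.add_im, Complex.ofReal_im, Complex.mul_im, Complex.I_re, Complex.I_im,
      Complex.ofReal_re]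
    ring
  have hx'' := abs_le.1 hx'
  have hcos0 : 0 ≤ Real.cos θ := Real.cos_nonneg_of_mem_Icc (abs_le.1 hθ)
  have hcos1 : Real.cos θ ≤ 1 := Real.cos_le_one θ
  have hsin := abs_le.1 (Real.abs_sin_le_one θ)
  have hhc : 0 ≤ h * Real.cos θ := mul_nonneg hh0.le hcos0
  have hhc1 : h * Real.cos θ ≤ h := mul_le_of_le_one_right hh0.le hcos1
  have hhs : h * (-1) ≤ h * Real.sin θ := mul_le_mul_of_nonneg_left hsin.1 hh0.le
  have hhs' : h * Real.sin θ ≤ h * 1 := mul_le_mul_of_nonneg_left hsin.2 hh0.le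
  have h0 : 0 ≤ s.re := by rw [hsre]; linarith only [hx''.1, hhc]
  have h1 : s.re ≤ 1 + δ := by rw [hsre]; linarith only [hhc1, hleft]
  have him12 : 12 ≤ s.im := by rw [hsim]; linarith only [hhs, hT, hH]
  have him_lo : T - h ≤ s.im := by rw [hsim]; linarith only [hhs]
  have him_hi : s.im ≤ T + h := by rw [hsim]; linarith only [hhs']
  have hmaj := norm_riemannXi_le_strip_majorant' h0 h1 hδ hδ1 him12
  -- `log(Im s) ≤ log(T + h)`
  have hlog : Real.log s.im ≤ Real.log (T + h) := Real.log_le_log (by linarith) him_hi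
  have hlog0 : 0 ≤ Real.log s.im := Real.log_nonneg (by linarith)
  -- vertical comparison from `Im s` to `T`, base height `T − h ≥ 2`
  have hvert := norm_xiGammaFactor_vertical_le_symm (σ := 1 + δ) (t := T) (t' := s.im) (t₀ := T - h)
    (by linarith) (by linarith) (by linarith) him_lo
  have hdt : |s.im - T| ≤ h := by
    rw [hsim, show T + h * Real.sin θ - T = h * Real.sin θ by ring, abs_mul, abs_of_pos hh0]
    exact mul_le_of_le_one_right hh0.le (Real.abs_sin_le_one θ)
  have hrate : (π / 4 + 6 / (T - h)) * |s.im - T| ≤ 4 / 5 * h := by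
    have h6 : 6 / (T - h) ≤ 1 / 100 := by
      rw [div_le_iff₀ (by linarith)]; linarith
    have hr0 : 0 ≤ π / 4 + 6 / (T - h) := by
      have : 0 ≤ 6 / (T - h) := div_nonneg (by norm_num) (by linarith)
      linarith only [this, Real.pi_pos]
    calc (π / 4 + 6 / (T - h)) * |s.im - T| ≤ (π / 4 + 6 / (T - h)) * h :=
          mul_le_mul_of_nonneg_left hdt hr0
      _ ≤ 4 / 5 * h := by
          apply mul_le_mul_of_nonneg_right _ hh0.le
          linarith only [Real.pi_lt_d2, h6]
  have hG : ‖xiGammaFactor (((1 + δ : ℝ) : ℂ) + (s.im : ℂ) * I)‖ ≤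
      ‖xiGammaFactor (((1 + δ : ℝ) : ℂ) + (T : ℂ) * I)‖ * Real.exp (4 / 5 * h) :=
    hvert.trans (mul_le_mul_of_nonneg_left (Real.exp_le_exp.2 hrate) (norm_nonneg _))
  have hG0 : 0 ≤ ‖xiGammaFactor (((1 + δ : ℝ) : ℂ) + (T : ℂ) * I)‖ := norm_nonneg _
  calc ‖riemannXi s‖ ≤ 672 * Real.log s.im * ‖xiGammaFactor (((1 + δ : ℝ) : ℂ) + (s.im : ℂ) * I)‖ := hmaj
    _ ≤ 672 * Real.log (T + h) *
        (‖xiGammaFactor (((1 + δ : ℝ) : ℂ) + (T : ℂ) * I)‖ * Real.exp (4 / 5 * h)) :=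
        mul_le_mul (by linarith only [hlog]) hG (norm_nonneg _)
          (mul_nonneg (by norm_num) (Real.log_nonneg (by linarith)))
    _ = 672 * Real.log (T + h) * Real.exp (4 / 5 * h) *
        ‖xiGammaFactor (((1 + δ : ℝ) : ℂ) + (T : ℂ) * I)‖ := by ring

/-! ## F7c: the line `σ = 1 + δ` against the own saddle -/

/-- **The abscissa `1 + δ` against the own saddle:** in regime R2, if `1 + δ ≤ σ* = Re(½ + u*)`
(`δ > −1`), then `‖γ̃((1+δ) + iT)‖ ≤ e^{h/3} · exp(−(σ* − (1+δ))·(ℓ_T/2 − 1)) · ‖γ̃(½ + u*)‖`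
(vertical comparison from `T` to `Im(½+u*)`, then horizontal comparison at that height, F1).
RH-FREE. [folklore] -/
theorem norm_xiGammaFactor_line_le_saddle {δ : ℝ} (hx : |x| ≤ 1 / 2) (hT : 100 ≤ T)
    (hℓ : 20 ≤ ell T) (hn : 100 ≤ n) (hh : 1 / 2 ≤ bandRadius n T)
    (hhT : bandRadius n T ≤ 7 / 20 * T) (hH : bandRadius n T ≤ 20)
    (hu : ‖u - ((x : ℂ) + (T : ℂ) * I + bandRadius n T)‖ ≤ 3 / 5 * bandRadius n T)
    (hS : arcSaddleFn n ((x : ℂ) + (T : ℂ) * I) u = 0) (hδ : 0 < 1 + δ)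
    (hδσ : 1 + δ ≤ (1 / 2 + u).re) :
    ‖xiGammaFactor (((1 + δ : ℝ) : ℂ) + (T : ℂ) * I)‖ ≤
      Real.exp (bandRadius n T / 3) *
        Real.exp (-(((1 / 2 + u).re - (1 + δ)) * (ell T / 2 - 1))) * ‖xiGammaFactor (1 / 2 + u)‖ := by
  obtain ⟨-, hεh, hε33, hT1200, -⟩ := R2_bookkeeping hT hℓ hh hH
  obtain ⟨-, him_abs, -, -⟩ := arcSaddle_sharp_polar hx hT hℓ hn hh hhT hH hu hS
  have hcim : ((x : ℂ) + (T : ℂ) * I).im = T := by simp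
  -- coordinates of `½ + u*`
  obtain ⟨σs, hσs⟩ : ∃ s : ℝ, s = (1 / 2 + u).re := ⟨_, rfl⟩
  obtain ⟨ts, hts⟩ : ∃ s : ℝ, s = (1 / 2 + u).im := ⟨_, rfl⟩
  have hss : (1 / 2 : ℂ) + u = (σs : ℂ) + (ts : ℂ) * I := by
    rw [hσs, hts]; exact (Complex.re_add_im _).symm
  have hts' : ts = T + (u - ((x : ℂ) + (T : ℂ) * I)).im := by
    rw [hts, Complex.add_im, Complex.sub_im, hcim]; simp
  rw [← hσs] at hδσ ⊢
  rw [hss]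
  generalize hh' : bandRadius n T = h at *
  have hh0 : 0 < h := by linarith only [hh]
  have him := abs_le.1 him_abs
  have htslo : T - 32 ≤ ts := by rw [hts']; linarith only [him.1, hε33]
  have hσs0 : 0 < σs := by linarith only [hδ, hδσ]
  -- vertical: `‖γ̃((1+δ)+iT)‖ ≤ ‖γ̃((1+δ)+i ts)‖ e^{(π/4 + 6/(T−32))|T − ts|}`
  have hv := norm_xiGammaFactor_vertical_le_symm (σ := 1 + δ) (t := ts) (t' := T) (t₀ := T - 32)
    hδ (by linarith only [hT1200]) htslo (by linarith only [hT1200])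
  have hdt : (π / 4 + 6 / (T - 32)) * |T - ts| ≤ h / 3 := by
    have h1 : |T - ts| ≤ 9 / 25 * h := by
      rw [hts', show T - (T + (u - ((x : ℂ) + (T : ℂ) * I)).im) = -(u - ((x : ℂ) + (T : ℂ) * I)).im by ring,
        abs_neg]
      exact him_abs.trans hεh
    have h6 : 6 / (T - 32) ≤ 1 / 100 := by
      rw [div_le_iff₀ (by linarith only [hT1200])]; linarith only [hT1200]
    have hr0 : 0 ≤ π / 4 + 6 / (T - 32) := by
      have : 0 ≤ 6 / (T - 32) := div_nonneg (by norm_num) (by linarith only [hT1200])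
      linarith only [this, Real.pi_pos]
    calc (π / 4 + 6 / (T - 32)) * |T - ts| ≤ (π / 4 + 6 / (T - 32)) * (9 / 25 * h) :=
          mul_le_mul_of_nonneg_left h1 hr0
      _ ≤ h / 3 := by nlinarith only [Real.pi_lt_d2, h6, hh0]
  -- horizontal at height `ts`: `‖γ̃((1+δ)+i ts)‖ ≤ ‖γ̃(σs + i ts)‖ e^{−(σs−(1+δ))(ell ts/2 − 6/ts)}`
  have hhz := norm_xiGammaFactor_le_of_re_le (σ₁ := 1 + δ) (σ₂ := σs) (t := ts) hδ hδσ
    (by linarith only [htslo, hT1200])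
  obtain ⟨hellt, h6t⟩ := ell_height_bounds hT1200 htslo
  have hrate : -((σs - (1 + δ)) * (ell ts / 2 - 6 / ts)) ≤ -((σs - (1 + δ)) * (ell T / 2 - 1)) := by
    have h1 : ell T / 2 - 1 ≤ ell ts / 2 - 6 / ts := by linarith only [hellt, h6t]
    have h2 : 0 ≤ σs - (1 + δ) := by linarith only [hδσ]
    nlinarith only [h1, h2]
  have hG0 : 0 ≤ ‖xiGammaFactor ((σs : ℂ) + (ts : ℂ) * I)‖ := norm_nonneg _
  calc ‖xiGammaFactor (((1 + δ : ℝ) : ℂ) + (T : ℂ) * I)‖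
      ≤ ‖xiGammaFactor (((1 + δ : ℝ) : ℂ) + (ts : ℂ) * I)‖ * Real.exp ((π / 4 + 6 / (T - 32)) * |T - ts|) := hv
    _ ≤ (‖xiGammaFactor ((σs : ℂ) + (ts : ℂ) * I)‖ *
          Real.exp (-((σs - (1 + δ)) * (ell ts / 2 - 6 / ts)))) * Real.exp (h / 3) :=
        mul_le_mul hhz (Real.exp_le_exp.2 hdt) (Real.exp_pos _).le (by positivity)
    _ ≤ (‖xiGammaFactor ((σs : ℂ) + (ts : ℂ) * I)‖ *
          Real.exp (-((σs - (1 + δ)) * (ell T / 2 - 1)))) * Real.exp (h / 3) := by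
        gcongr
    _ = Real.exp (h / 3) * Real.exp (-((σs - (1 + δ)) * (ell T / 2 - 1))) *
          ‖xiGammaFactor ((σs : ℂ) + (ts : ℂ) * I)‖ := by ring


end Summit.RiemannHypothesis.RiemannHypothesis.Theorems.JensenPolynomials.LogBandArc

end
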